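import Summits.Ventures.PercRepro.Night2NearFatSixTen
import Summits.Ventures.PercRepro.Night2NearFatAssembly

/-!
# night-2: h21's CELL `(2, 1)` AT `|G| = 16` WITH NO THREE-PLANAR HYPOTHESIS (gen 40)

At `|W| = 10` the non-suspect family (levels `≥ 6`) meets the loads of Night2NearFatSixTen: with no six-line every load is a
distance-1 load (`basis_pair_fair_of_ntp` with the shape lemma `dload_eq_zero_of_shape_of_no_six` and the cells of
Night2NearFatTen); with the six-line `R₀` the family excludes the `≤ 15` supersets of `R₀ ∖ Q` at level `6`
(`basis_pair_fair_of_ntpX` with `dload_eq_zero_of_shape_of_six` and the cells of Night2NearFatSixTen; two five-point basis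
lines leave no room for a long class): **`basis_pair_fair_ten_any`**.  **`localShadowHall_sixteen_of_lines`**: no fat closure and no
line of `V` with exactly nine points ⇒ the local Hall inequality at `|G| = 16`.  Paper: proofs/NIGHT-2-g40.md §9.  (Refresh resubmission 01:2xZ: the post-accept olean build of p751375 was dropped.)
-/

namespace PercRepro.Shadow

open PercRepro.ThmH PercRepro.PerFlat

variable {α : Type*} [DecidableEq α] {M : Matroid α} [M.Finite] {G : Finset α}

/-- **`N = 10` with no three-planar hypothesis**: every basis line with `≤ 6` points of `W` and every line through a basis
point with `≤ 8` ⇒ the basis pair is fair. -/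
theorem basis_pair_fair_ten_any (hG : G ∈ flatsQ M (5 + 1)) (hd : (gr M \ G).card = 2)
    (hk : kColoops M G = 1) (hs : ∀ e ∈ gr M, ∀ f ∈ gr M, e ≠ f → rkN M {e, f} = 2)
    (hl : ∀ e ∈ gr M, M.Indep {e}) (hnf : fatClosures M 5 G 2 = ∅)
    {B : Finset α} (hB : B ∈ thinMembers M 5 G) (hnP : ¬ bigP M G B) {z : α} (hz : z ∈ G \ clF M B)
    (hl0 : loss M 5 G B z ≠ 0) (hW : (G \ insert z B).card = 10)
    (h2 : ∀ a ∈ insert z B \ coloops M G, ∀ b ∈ insert z B \ coloops M G, a ≠ b →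
      ((G \ insert z B) ∩ clF M {a, b}).card ≤ 6)
    (h1 : ∀ a ∈ insert z B \ coloops M G, ∀ y ∈ G \ insert z B, ((G \ insert z B) ∩ clF M {a, y}).card ≤ 8) :
    loss M 5 G B z ≤ rhoL M 5 G B z * lossIncomeH M 5 G (bigP M G) (dshGT2 M 5 G) B z := by
  obtain ⟨ℓ₁, ℓ₂, C₁, C₂, hℓ₁, hℓ₂, hB2, hB1, ho₁, ho₂, hℓℓ, hc₁, hc₂, hcc, hℓc⟩ :=
    ntp_structure hG hd hk hs hl hB hnP hz (s := 6) (by norm_num) (by omega) (by omega)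
  have hGg : G ⊆ gr M := (mem_flatsQ.1 hG).1
  have hQG : insert z B ⊆ G := Finset.insert_subset (Finset.mem_sdiff.1 hz).1 (subset_G_of_mem_thinMembers hB)
  have hd₁ : ℓ₁.card = 0 ∨ (5 ≤ ℓ₁.card ∧ ℓ₁.card ≤ 6) := by
    rcases ho₁ with rfl | ⟨h5, a, ha, b, hb, hab, rfl⟩
    · exact Or.inl Finset.card_empty
    · exact Or.inr ⟨h5, h2 a ha b hb hab⟩
  have hd₂ : ℓ₂.card = 0 ∨ (5 ≤ ℓ₂.card ∧ ℓ₂.card ≤ 6) := by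
    rcases ho₂ with rfl | ⟨h5, a, ha, b, hb, hab, rfl⟩
    · exact Or.inl Finset.card_empty
    · exact Or.inr ⟨h5, h2 a ha b hb hab⟩
  have he₁ : C₁.card = 0 ∨ (6 ≤ C₁.card ∧ C₁.card ≤ 8) := by
    rcases hc₁ with rfl | ⟨h6, a, ha, y, hy, rfl⟩
    · exact Or.inl Finset.card_empty
    · exact Or.inr ⟨h6, h1 a ha y hy⟩
  have he₂ : C₂.card = 0 ∨ (6 ≤ C₂.card ∧ C₂.card ≤ 8) := by
    rcases hc₂ with rfl | ⟨h6, a, ha, y, hy, rfl⟩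
    · exact Or.inl Finset.card_empty
    · exact Or.inr ⟨h6, h1 a ha y hy⟩
  have hC₁W : C₁ ⊆ G \ insert z B := by
    rcases hc₁ with rfl | ⟨-, a, -, y, -, rfl⟩
    · exact Finset.empty_subset _
    · exact Finset.inter_subset_left
  have hC₂W : C₂ ⊆ G \ insert z B := by
    rcases hc₂ with rfl | ⟨-, a, -, y, -, rfl⟩
    · exact Finset.empty_subset _
    · exact Finset.inter_subset_left
  -- one long class
  have hone : ∃ C : Finset α, C ⊆ G \ insert z B ∧ (C.card = 0 ∨ (6 ≤ C.card ∧ C.card ≤ 8)) ∧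
      (∀ a ∈ insert z B \ coloops M G, ∀ y ∈ G \ insert z B,
        (G \ insert z B) ∩ clF M {a, y} ⊆ C ∨ ((G \ insert z B) ∩ clF M {a, y}).card + 1 ≤ 6) ∧
      (∀ ℓ : Finset α, (ℓ = ℓ₁ ∨ ℓ = ℓ₂) → ℓ = C ∨ (ℓ ∩ C).card ≤ 1) := by
    rcases hcc with heq | hint
    · refine ⟨C₁, hC₁W, he₁, ?_, fun ℓ hℓ => hℓc ℓ C₁ hℓ (Or.inl rfl)⟩
      intro a ha y hy
      rcases hB1 a ha y hy with h | h | h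
      · exact Or.inl h
      · exact Or.inl (heq ▸ h)
      · exact Or.inr h
    · have hone' : C₁.card = 0 ∨ C₂.card = 0 := by
        by_contra hno
        push Not at hno
        have hA := Finset.card_union_add_card_inter C₁ C₂
        have hU := Finset.card_le_card (Finset.union_subset hC₁W hC₂W)
        rcases he₁ with h | h
        · exact hno.1 h
        rcases he₂ with h' | h'
        · exact hno.2 h'
        omega
      rcases hone' with h0 | h0
      · refine ⟨C₂, hC₂W, he₂, ?_, fun ℓ hℓ => hℓc ℓ C₂ hℓ (Or.inr rfl)⟩
        intro a ha y hy
        rcases hB1 a ha y hy with h | h | h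
        · right
          rw [Finset.card_eq_zero] at h0
          rw [h0, Finset.subset_empty] at h
          rw [h, Finset.card_empty]
          norm_num
        · exact Or.inl h
        · exact Or.inr h
      · refine ⟨C₁, hC₁W, he₁, ?_, fun ℓ hℓ => hℓc ℓ C₁ hℓ (Or.inl rfl)⟩
        intro a ha y hy
        rcases hB1 a ha y hy with h | h | h
        · exact Or.inl h
        · right
          rw [Finset.card_eq_zero] at h0
          rw [h0, Finset.subset_empty] at h
          rw [h, Finset.card_empty]
          norm_num
        · exact Or.inr h
  obtain ⟨C, hCW, heC, hB1', hℓC⟩ := hone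
  have hjoint : ∀ ℓ : Finset α, (ℓ = ℓ₁ ∨ ℓ = ℓ₂) → ℓ ⊆ G \ insert z B → 6 ≤ ℓ.card → C.card ≤ 7 := by
    intro ℓ hℓ hℓW h6
    rcases hℓC ℓ hℓ with heq | hint
    · rw [← heq]
      rcases hℓ with rfl | rfl
      · rcases hd₁ with h | h <;> omega
      · rcases hd₂ with h | h <;> omega
    · have hA := Finset.card_union_add_card_inter ℓ C
      have hU := Finset.card_le_card (Finset.union_subset hℓW hCW)
      omega
  have hB1'' : ∀ a ∈ insert z B \ coloops M G, ∀ y ∈ G \ insert z B,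
      (G \ insert z B) ∩ clF M {a, y} ⊆ C ∨ (G \ insert z B) ∩ clF M {a, y} ⊆ (∅ : Finset α) ∨
        ((G \ insert z B) ∩ clF M {a, y}).card + 1 ≤ 6 := by
    intro a ha y hy
    rcases hB1' a ha y hy with h | h
    · exact Or.inl h
    · exact Or.inr (Or.inr h)
  -- the two basis lines: equal (then `(ℓ₁, ∅)`) or disjoint
  have hlines : ∃ ℓ₁' ℓ₂' : Finset α, ℓ₁' ⊆ G \ insert z B ∧ ℓ₂' ⊆ G \ insert z B ∧
      (∀ a ∈ insert z B \ coloops M G, ∀ b ∈ insert z B \ coloops M G, a ≠ b →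
        (G \ insert z B) ∩ clF M {a, b} ⊆ ℓ₁' ∨ (G \ insert z B) ∩ clF M {a, b} ⊆ ℓ₂' ∨
          ((G \ insert z B) ∩ clF M {a, b}).card + 2 ≤ 6) ∧
      (ℓ₁'.card = 0 ∨ (5 ≤ ℓ₁'.card ∧ ℓ₁'.card ≤ 6)) ∧ (ℓ₂'.card = 0 ∨ (5 ≤ ℓ₂'.card ∧ ℓ₂'.card ≤ 6)) ∧
      ℓ₁'.card + ℓ₂'.card ≤ 10 ∧ (6 ≤ ℓ₁'.card ∨ 6 ≤ ℓ₂'.card → C.card ≤ 7) ∧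
      (5 ≤ ℓ₁'.card → 5 ≤ ℓ₂'.card → C.card ≤ 6) := by
    rcases hℓℓ with heq | hdisj
    · refine ⟨ℓ₁, ∅, hℓ₁, Finset.empty_subset _, ?_, hd₁, Or.inl Finset.card_empty, ?_, ?_, ?_⟩
      · intro a ha b hb hab
        rcases hB2 a ha b hb hab with h | h | h
        · exact Or.inl h
        · exact Or.inl (heq ▸ h)
        · exact Or.inr (Or.inr h)
      · rw [Finset.card_empty]
        rcases hd₁ with h | h <;> omega
      · intro h6
        rcases h6 with h6 | h6
        · exact hjoint ℓ₁ (Or.inl rfl) hℓ₁ h6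
        · rw [Finset.card_empty] at h6
          omega
      · intro _ h5
        rw [Finset.card_empty] at h5
        omega
    · refine ⟨ℓ₁, ℓ₂, hℓ₁, hℓ₂, hB2, hd₁, hd₂, ?_, ?_, ?_⟩
      · have hA := Finset.card_union_add_card_inter ℓ₁ ℓ₂
        have hU := Finset.card_le_card (Finset.union_subset hℓ₁ hℓ₂)
        omega
      · intro h6
        rcases h6 with h6 | h6
        · exact hjoint ℓ₁ (Or.inl rfl) hℓ₁ h6
        · exact hjoint ℓ₂ (Or.inr rfl) hℓ₂ h6
      · -- two five-point lines leave no room for a class of `≥ 7` points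
        intro h5₁ h5₂
        rcases hℓC ℓ₁ (Or.inl rfl) with heq₁ | hint₁
        · rw [← heq₁]
          rcases hd₁ with h | h <;> omega
        rcases hℓC ℓ₂ (Or.inr rfl) with heq₂ | hint₂
        · rw [← heq₂]
          rcases hd₂ with h | h <;> omega
        have hA := Finset.card_union_add_card_inter ℓ₁ ℓ₂
        have hB' := Finset.card_union_add_card_inter (ℓ₁ ∪ ℓ₂) C
        have hI : ((ℓ₁ ∪ ℓ₂) ∩ C).card ≤ 2 := by
          rw [Finset.union_inter_distrib_right]
          have := Finset.card_union_le (ℓ₁ ∩ C) (ℓ₂ ∩ C)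
          omega
        have hU := Finset.card_le_card (Finset.union_subset (Finset.union_subset hℓ₁ hℓ₂) hCW)
        omega
  obtain ⟨ℓ₁', ℓ₂', hℓ₁', hℓ₂', hB2', hd₁', hd₂', hsum', hjoint', h55'⟩ := hlines
  have hV15 : (G \ coloops M G).card = 15 := by
    rw [card_sdiff_coloops_eq_sub_one hk]
    have := card_sdiff_insert_eq_card_sub_six hG hd hk hB hnP hz
    have hQ6 : 6 ≤ G.card := by
      have h5 := (rkN_insert_sdiff_coloops_eq_five hG hd hk hB hnP hz).2
      have hKQ : coloops M G ⊆ insert z B :=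
        fun x hx => Finset.mem_insert_of_mem (coloops_subset_of_mem_thinMembers hG (by omega) hB hx)
      have := Finset.card_sdiff_of_subset hKQ
      have := Finset.card_le_card hQG
      omega
    omega
  by_cases hsix : ∃ B' ∈ thinMembers M 5 G, 5 ≤ (B' \ coloops M G).card ∧ ∃ z' ∈ G \ clF M B',
      loss M 5 G B' z' ≠ 0 ∧ gtPts M 5 G (insert z' B') = ∅ ∧ ∃ R ⊆ insert z' B' \ coloops M G, rkN M R = 2 ∧
        R.card + 3 = (insert z' B' \ coloops M G).card ∧
        ((G \ coloops M G) ∩ clF M R).card + 9 = (G \ coloops M G).card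
  · -- THE SIX-LINE CASE
    obtain ⟨B₀, hB₀, hbig₀, z₀, hz₀, hloss₀, hempty₀, R₀, hRQ₀, hR2₀, hRcard₀, h9₀⟩ := hsix
    have h6₀ : ((G \ coloops M G) ∩ clF M R₀).card = 6 := by omega
    set L₀ := ((G \ coloops M G) ∩ clF M R₀) \ insert z B with hL₀
    have hL₀W : L₀ ⊆ G \ insert z B := fun v hv => by
      rw [hL₀, Finset.mem_sdiff, Finset.mem_inter, Finset.mem_sdiff] at hv
      exact Finset.mem_sdiff.2 ⟨hv.1.1.1, hv.2⟩
    -- `|L₀| ≥ 4`: the basis meets the line in `≤ 2` points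
    have hL₀4 : 4 ≤ L₀.card := by
      have hind : M.Indep ((insert z B \ coloops M G : Finset α) : Set α) :=
        (indep_insert_of_basis_pair hG hd hk hB hnP hz).subset (by exact_mod_cast (Finset.sdiff_subset))
      have hQ'R : ((insert z B \ coloops M G) ∩ clF M R₀).card ≤ 2 :=
        card_inter_le_two_of_indep_of_rkN_le_two hind (by rw [rkN_clF, hR2₀])
      have hsplit : L₀.card + (((G \ coloops M G) ∩ clF M R₀) ∩ insert z B).card =
          ((G \ coloops M G) ∩ clF M R₀).card :=
        Finset.card_sdiff_add_card_inter ((G \ coloops M G) ∩ clF M R₀) (insert z B)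
      have hsub : ((G \ coloops M G) ∩ clF M R₀) ∩ insert z B ⊆ (insert z B \ coloops M G) ∩ clF M R₀ := by
        intro v hv
        rw [Finset.mem_inter, Finset.mem_inter, Finset.mem_sdiff] at hv
        rw [Finset.mem_inter, Finset.mem_sdiff]
        exact ⟨⟨hv.2, hv.1.1.2⟩, hv.1.2⟩
      have := Finset.card_le_card hsub
      omega
    have hL₀6 : L₀.card ≤ 6 := by
      have h : L₀.card ≤ ((G \ coloops M G) ∩ clF M R₀).card :=
        Finset.card_le_card (Finset.sdiff_subset (s := (G \ coloops M G) ∩ clF M R₀) (t := insert z B))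
      omega
    have hx : (((G \ insert z B).powersetCard 6).filter (fun Y => L₀ ⊆ Y)).card ≤ 15 := by
      refine le_trans (card_filter_superset_le (G \ insert z B) L₀ 6) ?_
      rw [Finset.card_sdiff_of_subset hL₀W, hW]
      interval_cases L₀.card <;> norm_num [Nat.choose]
    apply basis_pair_fair_of_ntpX hG hd hk hs hl hnf hB hnP hz hl0 (by norm_num : 1 ≤ 6) hx _ hℓ₁' hℓ₂' hB2'
      (C₁ := C) (C₂ := ∅) hB1''
    · rw [hW, Finset.card_empty]
      exact one_le_ntpIncomeX_ten_of ℓ₁'.card ℓ₂'.card C.card hd₁' hd₂' hsum'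
        (by rcases heC with h | h <;> omega) hjoint' h55'
    · intro Y hYW hYs hnS hnsix
      apply dload_eq_zero_of_shape_of_six hG hd hk hs hl hnf hV15 hB₀ hbig₀ hz₀ hloss₀ hRQ₀ hR2₀ hRcard₀ hempty₀ h6₀
        hB hnP hz hYW (by omega)
      · intro a ha b hb hab
        by_contra hlt
        exact hnS (Or.inl ⟨a, ha, b, hb, hab, by omega⟩)
      · intro a ha y hy hsub
        exact hnS (Or.inr ⟨a, ha, y, hy, hsub⟩)
      · exact hnsix
  · -- NO SIX-LINE: every load above level five is a distance-1 load
    apply basis_pair_fair_of_ntp hG hd hk hs hl hnf hB hnP hz hl0 (by norm_num : 1 ≤ 6) _ hℓ₁' hℓ₂' hB2'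
      (C₁ := C) (C₂ := ∅) hB1''
    · rw [hW, Finset.card_empty]
      exact one_le_ntpIncome_ten_of ℓ₁'.card ℓ₂'.card C.card hd₁' hd₂' hsum'
        (by rcases heC with h | h <;> omega) hjoint'
    · intro Y hYW hYs hnS
      apply dload_eq_zero_of_shape_of_no_six hG hd hk hs hl hnf hsix hB hnP hz hYW (by omega)
      · intro a ha b hb hab
        by_contra hlt
        exact hnS (Or.inl ⟨a, ha, b, hb, hab, by omega⟩)
      · intro a ha y hy hsub
        exact hnS (Or.inr ⟨a, ha, y, hy, hsub⟩)

/-- **h21's cell `(2, 1)` at `|G| = 16` with no three-planar hypothesis**: no fat closure and no line of `V` with exactly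
nine points. -/
theorem localShadowHall_sixteen_of_lines (hG : G ∈ flatsQ M (5 + 1)) (hd : (gr M \ G).card = 2)
    (hk : kColoops M G = 1) (hs : ∀ e ∈ gr M, ∀ f ∈ gr M, e ≠ f → rkN M {e, f} = 2)
    (hl : ∀ e ∈ gr M, M.Indep {e}) (hnf : fatClosures M 5 G 2 = ∅) (h16 : G.card = 16)
    (hline : ∀ u ∈ G \ coloops M G, ∀ v ∈ G \ coloops M G, u ≠ v → ((G \ coloops M G) ∩ clF M {u, v}).card ≠ 9) :
    LocalShadowHall M 5 G := by
  by_cases hlong : ∃ u ∈ G \ coloops M G, ∃ v ∈ G \ coloops M G, u ≠ v ∧ 10 ≤ ((G \ coloops M G) ∩ clF M {u, v}).card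
  · obtain ⟨u, hu, v, hv, huv, h10⟩ := hlong
    apply localShadowHall_of_long_line hG hd hk hs hl hu hv huv
    rw [card_sdiff_coloops_eq_sub_one hk]
    omega
  · push Not at hlong
    have hline' : ∀ u ∈ G \ coloops M G, ∀ v ∈ G \ coloops M G, u ≠ v →
        ((G \ coloops M G) ∩ clF M {u, v}).card ≤ 8 := by
      intro u hu v hv huv
      have := hlong u hu v hv huv
      have := hline u hu v hv huv
      omega
    have hfat : (fatClosures M 5 G 2).card ≤ 1 := by
      rw [hnf, Finset.card_empty]
      exact zero_le_one
    apply localShadowHall_of_gt2_of_basis_fair hG hd hk hs hl hfat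
    intro B hB hnP z hz
    by_cases hl0 : loss M 5 G B z = 0
    · rw [hl0]
      have hd' : (gr M \ G).card ≤ 5 := by omega
      have h1 : 0 ≤ rhoL M 5 G B z := by
        unfold rhoL
        rw [hl0]
        simp
      have h2 : 0 ≤ lossIncomeH M 5 G (bigP M G) (dshGT2 M 5 G) B z :=
        lossIncomeH_nonneg hG hd' (column_side_gt2 hG hd hk hs hl hfat) B z
      positivity
    · have hQG : insert z B ⊆ G := Finset.insert_subset (Finset.mem_sdiff.1 hz).1 (subset_G_of_mem_thinMembers hB)
      have hW := card_sdiff_insert_eq_card_sub_six hG hd hk hB hnP hz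
      have hQ'V : ∀ a ∈ insert z B \ coloops M G, a ∈ G \ coloops M G := fun a ha =>
        Finset.mem_sdiff.2 ⟨hQG (Finset.mem_sdiff.1 ha).1, (Finset.mem_sdiff.1 ha).2⟩
      have hWV : ∀ y ∈ G \ insert z B, y ∈ G \ coloops M G := fun y hy =>
        Finset.mem_sdiff.2 ⟨(Finset.mem_sdiff.1 hy).1, fun hK => (Finset.mem_sdiff.1 hy).2
          (Finset.mem_insert_of_mem (coloops_subset_of_mem_thinMembers hG (by omega) hB hK))⟩
      apply basis_pair_fair_ten_any hG hd hk hs hl hnf hB hnP hz hl0 (by omega)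
      · intro a ha b hb hab
        have := le_trans (card_inter_W_add_two_le hG hd hB hz ha hb hab) (hline' a (hQ'V a ha) b (hQ'V b hb) hab)
        omega
      · intro a ha y hy
        have hay : a ≠ y := fun h => (Finset.mem_sdiff.1 hy).2 (h ▸ (Finset.mem_sdiff.1 ha).1)
        have := le_trans (card_inter_W_add_one_le hG hd hB hz ha hy) (hline' a (hQ'V a ha) y (hWV y hy) hay)
        omega

end PercRepro.Shadow
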